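import Summits.ValiantsHypothesis.ValiantsHypothesis.Theses.ValuativeGCT

/-! Refuter drefute (stmt-ValiantsHypothesis-12626, line adjugate-pfaffian-kernel): the lead's def-free
`stub_adjDet_sparsePoint` at `m = 3`, proved exactly as typed (positive instance; candidate template for the
prover).  Sparse skew point: row `(k,k)` = `vec S_k`, `S_k = P_k (J ⊕ 0) P_kᵀ`, other rows `0`;
`cof S_k = E_kk`, `W_3 = det 1 = 1`. -/

open Literature.NumberTheory.DiophantineGeometry Literature.Computability.AlgebraicComplexity
open MvPolynomial
open scoped BigOperators Matrix

namespace DrefuteStub6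

/-- The three skew slot matrices `S_0, S_1, S_2` (`S_2 = J ⊕ 0`, `S_k` = conjugate by `(k 2)`). -/
def slotRow : Fin 3 → Matrix (Fin 3) (Fin 3) ℂ
  | 0 => !![0, 0, 0; 0, 0, -1; 0, 1, 0]
  | 1 => !![0, 0, 1; 0, 0, 0; -1, 0, 0]
  | 2 => !![0, 1, 0; -1, 0, 0; 0, 0, 0]

/-- The sparse point of `End(ℂ^{3×3})`: row `(k,k)` is `vec S_k`, every other row is `0`. -/
def pS : MatIdx 3 × MatIdx 3 → ℂ := fun q =>
  if (ofLex q.1).1 = (ofLex q.1).2 then slotRow (ofLex q.1).1 (ofLex q.2).1 (ofLex q.2).2 else 0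

theorem pS_rows_skew (j : MatIdx 3) :
    (fun i => pS (j, i)) ∈
      Submodule.span ℂ {u : MatIdx 3 → ℂ | ∀ a b : Fin 3, u (toLex (a, b)) = -u (toLex (b, a))} := by
  obtain ⟨⟨j1, j2⟩, rfl⟩ := toLex.surjective j
  refine Submodule.subset_span fun a b => ?_
  fin_cases j1 <;> fin_cases j2 <;> fin_cases a <;> fin_cases b <;> simp [pS, slotRow]

theorem sum_cof_slotRow : ∑ k : Fin 3, (slotRow k).adjugateᵀ = 1 := by
  ext a b
  simp only [Fin.sum_univ_three, Matrix.add_apply, Matrix.transpose_apply, Matrix.adjugate_fin_three]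
  fin_cases a <;> fin_cases b <;> simp [slotRow]

/-- **Stub 6 at `m = 3`, literally as typed by the lead** (odd `m = 3 ≥ 3`). -/
theorem stub_adjDet_sparsePoint_three :
    ∃ p : MatIdx 3 × MatIdx 3 → ℂ,
      (∀ j : MatIdx 3, (fun i => p (j, i)) ∈
        Submodule.span ℂ {u : MatIdx 3 → ℂ | ∀ a b : Fin 3, u (toLex (a, b)) = -u (toLex (b, a))}) ∧
      MvPolynomial.eval p (Matrix.det (∑ k : Fin 3, (Matrix.of fun a b : Fin 3 =>
        (X (toLex (k, k), toLex (a, b)) : MvPolynomial (MatIdx 3 × MatIdx 3) ℂ)).adjugateᵀ)) ≠ 0 := by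
  refine ⟨pS, pS_rows_skew, ?_⟩
  have hrow : ∀ k : Fin 3, (MvPolynomial.eval pS).mapMatrix
      (Matrix.of fun a b : Fin 3 => (X (toLex (k, k), toLex (a, b)) : MvPolynomial (MatIdx 3 × MatIdx 3) ℂ))
        = slotRow k := by
    intro k
    ext a b
    simp [pS]
  have h : MvPolynomial.eval pS (Matrix.det (∑ k : Fin 3, (Matrix.of fun a b : Fin 3 =>
      (X (toLex (k, k), toLex (a, b)) : MvPolynomial (MatIdx 3 × MatIdx 3) ℂ)).adjugateᵀ))
        = Matrix.det (∑ k : Fin 3, (slotRow k).adjugateᵀ) := by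
    rw [RingHom.map_det, map_sum]
    congr 1
    refine Finset.sum_congr rfl fun k _ => ?_
    rw [RingHom.mapMatrix_apply, Matrix.transpose_map, ← RingHom.mapMatrix_apply, RingHom.map_adjugate, hrow]
  rw [h, sum_cof_slotRow, Matrix.det_one]
  exact one_ne_zero

end DrefuteStub6
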